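import Summits.Parity.GeneralizedHardyLittlewood.Theorems.LeeYangFibresPrimeCellsRelativeChowlaClipsParityPos
import Summits.Parity.GeneralizedHardyLittlewood.Theorems.LeeYangFibresPrimeCellsRelativeSieveTransfer
import Summits.Parity.GeneralizedHardyLittlewood.Theorems.LeeYangFibresPrimeCellsRelativeWalshExtraction
import Summits.Parity.GeneralizedHardyLittlewood.Theorems.LeeYangFibresPrimeCellsRelativeSingletonClassSums
import Summits.Parity.GeneralizedHardyLittlewood.Theorems.LeeYangFibresPrimeCellsRelativeWeightedFromMeanPos
import Summits.Parity.GeneralizedHardyLittlewood.Theorems.LeeYangFibresAbsoluteUpgradeRoughAnatomy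
import Summits.Parity.GeneralizedHardyLittlewood.Theorems.LeeYangFibresModelCellFacts
import HarnessLib

/-!
# Route `LeeYangFibres`, crux `PrimeCellsRelative` (stmt-Parity-14112), line `SketchIdeator4`
# (card `sieve-out-to-chowla`): the line theorem SLICED at a fixed number of forms

The line's composition `stub_chowlaClipsParityPos` (file
`Theorems/LeeYangFibresPrimeCellsRelativeChowlaClipsParityPos.lean`) fixes the number of forms `t` of the
system before choosing any constant, and consumes the route's `CellParityLaw` and the positive weighted class
sums only at that `t`.  So the line theorem localises:

* `primeCellsRelativeAt_of_cellParityLawAt` (registered sub-goal of stmt-Parity-14112) — for every `t ≥ 1`,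
  **`CellParityLawAt t → LiouvilleTupleMeanPos t → PrimeCellsRelativeAt t`**: the slice of Bombieri's cell
  parity law at `t` forms and the Bombieri–Vinogradov mean value for `k`-point Liouville correlations
  (`2 ≤ k ≤ t`) along `t`-form systems on positive intervals give the counting Dickson–Hardy–Littlewood law for
  the joint rough prime cell of `t` forms with Green–Tao's relative + absolute error.  Proof: the proof of
  `stub_chowlaClipsParityPos` with `t` fixed first, fed BY NAME with the landed `stub_sieveTransfer`,
  `stub_walshExtraction`, `stub_singletonClassSums`, `stub_weightedFromMeanPos t`, `stub_roughAnatomy` and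
  `modelCellFacts_proof`; the only change is that the positive weighted class sums are uniformised at the
  fixed `t` (`weightedPos_uniform_at`, no case split on `t`).
* `primeCellsRelativeAt_two_of_cellParityLawAt_two` — the PAIR content of the crux (`t = 2`: twins, Sophie
  Germain, binary Goldbach to relative accuracy) needs only the pair law `CellParityLawAt 2` and the 2-point
  input `LiouvilleTupleMeanPos 2`.
* `primeCellsRelative_of_cellParityLaw_of_liouvilleTupleMeanPos'` — the global line theorem recovered from the
  slices (consistency check): `CellParityLaw → (∀ t ≥ 2, LiouvilleTupleMeanPos t) → PrimeCellsRelative`, via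
  `cellParityLaw_iff_forall_at`, `primeCellsRelative_iff_forall_at` and the vacuous
  `liouvilleTupleMeanPos_of_le_one` at `t = 1`.

Both hypotheses are conjecture-grade and appear only as hypotheses; nothing is asserted about them.

References: Bombieri 1976 [BombieriAsymptoticSieve1976] (the cell parity law); Green–Tao 2010 Conj. 1.4
[GreenTao2010] (error shape, normalisations `β_∞`, `∏_p β_p`); Friedlander–Iwaniec, Opera de Cribro, Cor. 6.10
[FriedlanderIwaniecOpera2010] (the `e^{-s}` of the sieve transfer); Tao 2016 [TaoFMP2016] (species of the
parity input).
-/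

noncomputable section

open scoped BigOperators Classical
open Finset Filter

namespace Summit.Parity.GeneralizedHardyLittlewood.Cruxes.PrimeCellsRelative.SieveOutToChowla

open Literature.NumberTheory.Sieve
open Summit.Parity.GeneralizedHardyLittlewood.Theses.LeeYangFibres
open Summit.Parity.GeneralizedHardyLittlewood.Cruxes.AbsoluteUpgrade.NlcCellsAbsoluteClip
  (roughTuples jointCell walshForm modelCell roughCell RoughAnatomy)
open Summit.Parity.GeneralizedHardyLittlewood.Theorems.AbsoluteUpgrade
open Summit.Parity.GeneralizedHardyLittlewood.Cruxes.CellParityLaw.SectionAnnihilator.SingularRatio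
  (singularProduct_nonneg)

/-! ## The positive weighted class sums at a fixed `t`, with a non-negative constant -/

/-- The positive-forms weighted class sums at a fixed number of forms `t`, with a non-negative constant
(replace `C` by `max C 0`). [folklore] -/
theorem weightedPos_uniform_at {t : ℕ} (hWT : WeightedTupleClassSumsPos t) (L : ℕ) :
    ∃ η : ℝ, 0 < η ∧ ∃ C : ℝ, 0 ≤ C ∧ ∃ N₀ : ℕ, ∀ N : ℕ, N₀ ≤ N →
      ∀ Ψ : Fin t → AffLinForm 1, IsNondegenerateSystem Ψ → affLinSize Ψ N ≤ L →
      ∀ m₁ m₂ : ℤ, Finset.Icc m₁ m₂ ⊆ Finset.Icc (-(N : ℤ)) N →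
        (∀ m ∈ Finset.Icc m₁ m₂, ∀ k, 1 ≤ (Ψ k).eval (fun _ => m)) →
      ∀ S : Finset (Fin t), 2 ≤ S.card →
        rootClassSums Ψ S m₁ m₂ ⌊(N : ℝ) ^ η⌋₊ ≤ C * N / Real.log N ^ (t + 1) := by
  obtain ⟨η, hη, C, N₀, h⟩ := hWT L
  refine ⟨η, hη, max C 0, le_max_right _ _, N₀, fun N hN Ψ hΨ hL m₁ m₂ hI hpos S hS => ?_⟩
  refine (h N hN Ψ hΨ hL m₁ m₂ hI hpos S hS).trans ?_
  have h0 : 0 ≤ (N : ℝ) / Real.log N ^ (t + 1) :=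
    div_nonneg (Nat.cast_nonneg N) (pow_nonneg (Real.log_natCast_nonneg N) _)
  calc C * N / Real.log N ^ (t + 1) = C * (N / Real.log N ^ (t + 1)) := by ring
    _ ≤ max C 0 * (N / Real.log N ^ (t + 1)) := mul_le_mul_of_nonneg_right (le_max_left _ _) h0
    _ = max C 0 * N / Real.log N ^ (t + 1) := by ring

/-! ## The sliced line theorem -/

/-- **`primeCellsRelativeAt_of_cellParityLawAt` (registered sub-goal of stmt-Parity-14112) — the line theorem
of `SketchIdeator4` at a fixed number of forms.**  For every `t ≥ 1`: the route's cell parity law at `t` forms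
(`CellParityLawAt t`) and the Bombieri–Vinogradov mean value for `k`-point Liouville correlations along
`t`-form systems on positive intervals (`LiouvilleTupleMeanPos t`) imply the counting Dickson–Hardy–Littlewood
law for the joint rough prime cell of `t` forms with relative + absolute error (`PrimeCellsRelativeAt t`).
Proof: the constant schedule of `stub_chowlaClipsParityPos` with `t` fixed first
(`ε → δ → ε_M → u₀, c, C, C₁, C₂, η → s → u → ε_law → N₀`), fed by name with the landed
`stub_sieveTransfer`, `stub_walshExtraction`, `stub_singletonClassSums`, `stub_weightedFromMeanPos t`,
`stub_roughAnatomy`, `modelCellFacts_proof`. [cite: GreenTao2010, Conj. 1.4] -/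
theorem primeCellsRelativeAt_of_cellParityLawAt : ∀ t : ℕ, 1 ≤ t → CellParityLawAt t → LiouvilleTupleMeanPos t → PrimeCellsRelativeAt t := by
  intro t ht hCPL hChowla
  -- the landed inputs, by name
  have hST : SieveTransfer := stub_sieveTransfer
  have hWE : WalshExtraction := stub_walshExtraction
  have hSC : SingletonClassSums := stub_singletonClassSums
  have hRA : RoughAnatomy :=
    Summit.Parity.GeneralizedHardyLittlewood.Theorems.AbsoluteUpgrade.stub_roughAnatomy
  have hMC : ModelCellFacts := Summit.Parity.GeneralizedHardyLittlewood.Theorems.modelCellFacts_proof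
  have hWTt : WeightedTupleClassSumsPos t := stub_weightedFromMeanPos t hChowla
  unfold CellParityLawAt at hCPL
  unfold PrimeCellsRelativeAt
  intro L ε hε
  -- the constants `δ, ε_M`
  obtain ⟨δ, hδ⟩ : ∃ δ : ℝ, δ = ε / 2 ^ (t + 2) := ⟨_, rfl⟩
  have hδ0 : 0 < δ := by rw [hδ]; positivity
  obtain ⟨εM, hεM⟩ : ∃ εM : ℝ, εM = δ / 2 ^ (t + 1) := ⟨_, rfl⟩
  have hεM0 : 0 < εM := by rw [hεM]; positivity
  -- `u₀` (parity balance), `c` (anatomy), `C` (sieve), `C₁, C₂, η` (class sums)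
  obtain ⟨u₀, hu₀⟩ := hMC εM hεM0
  obtain ⟨c, hc, Nra, hra⟩ := hRA 1
  obtain ⟨C, hC0, hst⟩ := hST t L
  obtain ⟨C₁, hC₁, Ns, hsc⟩ := hSC t L
  obtain ⟨η, hη, C₂, hC₂, Nw, hw⟩ := weightedPos_uniform_at hWTt L
  -- `s` with `C e^{-s} ≤ δ c^t`
  obtain ⟨s, hs⟩ : ∃ s : ℝ, s = max 1 (Real.log ((C + 1) / (δ * c ^ t))) := ⟨_, rfl⟩
  have hs1 : 1 ≤ s := (le_max_left _ _).trans_eq hs.symm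
  have hCs : C * Real.exp (-s) ≤ δ * c ^ t :=
    coeff_mul_exp_le (Q := C + 1) (by linarith) (by linarith) (by positivity)
      ((le_max_right _ _).trans_eq hs.symm)
  -- the roughness `u`
  obtain ⟨u, hu⟩ : ∃ u : ℕ, u = max (max u₀ 4) ⌈max (16 * s) (2 * s / η)⌉₊ := ⟨_, rfl⟩
  have hu₀u : u₀ ≤ u := by rw [hu]; exact (le_max_left _ _).trans (le_max_left _ _)
  have hu4 : 4 ≤ u := by rw [hu]; exact (le_max_right _ _).trans (le_max_left _ _)
  have hureal : max (16 * s) (2 * s / η) ≤ (u : ℝ) :=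
    (Nat.le_ceil _).trans (by rw [hu]; exact_mod_cast le_max_right _ _)
  have h16 : 16 * s ≤ (u : ℝ) := (le_max_left _ _).trans hureal
  have h2η : 2 * s / η ≤ (u : ℝ) := (le_max_right _ _).trans hureal
  have hu0 : (0 : ℝ) < u := by exact_mod_cast (show 0 < u by omega)
  have h4s : 4 * s ≤ (u : ℝ) := by linarith
  have hsu8 : 2 * s / u ≤ 1 / 8 := by rw [div_le_iff₀ hu0]; linarith
  have hsuη : 2 * s / u ≤ η := by
    rw [div_le_iff₀ hu0]; rw [div_le_iff₀ hη] at h2η; linarith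
  -- `ε_law`
  obtain ⟨εlaw, hεlaw⟩ : ∃ x : ℝ, x = ε / (2 ^ (t + 2) * ((2 / c) ^ t + 1)) := ⟨_, rfl⟩
  have hεlaw0 : 0 < εlaw := by rw [hεlaw]; positivity
  -- the remaining thresholds and `N₀`
  obtain ⟨Nl, hl⟩ := hCPL L u (by omega) εlaw hεlaw0
  obtain ⟨Nst, hst'⟩ := hst s hs1 u h4s
  obtain ⟨j₁, j₂, -, -, -, -, -, -, c', -, Nm, hm⟩ := hu₀ u hu₀u
  have h3 : Tendsto (fun N : ℕ => Real.log (Real.log (Real.log (N : ℝ)))) atTop atTop :=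
    Real.tendsto_log_atTop.comp (Real.tendsto_log_atTop.comp
      (Real.tendsto_log_atTop.comp tendsto_natCast_atTop_atTop))
  have h1u : (0 : ℝ) < 1 / u := by positivity
  obtain ⟨N₀, hN₀⟩ := Filter.eventually_atTop.mp <| show ∀ᶠ N : ℕ in atTop,
      (Nra ≤ N ∧ Ns ≤ N ∧ Nw ≤ N ∧ Nl ≤ N ∧ Nst ≤ N ∧ Nm ≤ N) ∧
      ((16 : ℝ) ≤ N ∧ 1 ≤ Real.log N) ∧ (2 : ℝ) ≤ (N : ℝ) ^ ((1 : ℝ) / u) ∧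
      (2 * L : ℝ) ≤ (N : ℝ) ^ ((1 : ℝ) / u) ∧ (u : ℝ) ≤ Real.log (Real.log (Real.log N)) ∧
      (C₁ + C₂ + 1) / δ ≤ Real.log N from by
    filter_upwards [eventually_ge_atTop Nra, eventually_ge_atTop Ns, eventually_ge_atTop Nw,
      eventually_ge_atTop Nl, eventually_ge_atTop Nst, eventually_ge_atTop Nm, eventually_basic,
      eventually_rpow_ge 2 h1u, eventually_rpow_ge (2 * L : ℝ) h1u, h3.eventually_ge_atTop (u : ℝ),
      eventually_log_ge ((C₁ + C₂ + 1) / δ)] with N k1 k2 k3 k4 k5 k6 k7 k8 k9 k10 k11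
    exact ⟨⟨k1, k2, k3, k4, k5, k6⟩, k7, k8, k9, k10, k11⟩
  refine ⟨u, by omega, N₀, fun N hN Ψ hΨ hL K hK hKN => ?_⟩
  obtain ⟨⟨hNra, hNs, hNw, hNl, hNst, hNm⟩, ⟨hN16, hℓ1⟩, h2, h2L, hulog, hjunk⟩ := hN₀ N hN
  have hNpos : (0 : ℝ) < N := by linarith
  have hN1 : 1 ≤ N := by exact_mod_cast (show (1 : ℝ) ≤ N by linarith)
  have hℓ0 : 0 < Real.log N := by linarith
  -- the number-theoretic inputs at this scale
  obtain ⟨-, hA1, hAsum⟩ := hra N hNra u hu4 (by rw [one_mul]; exact hulog)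
  have hbal : |∑ j ∈ Finset.Icc 1 u, (-1 : ℝ) ^ j * (roughCell N u j : ℝ)| ≤
      εM * ∑ j ∈ Finset.Icc 1 u, (roughCell N u j : ℝ) := (hm N hNm).2.2
  obtain ⟨θ, hθ0, hθ2, hlaw⟩ := hl N hNl Ψ hΨ hL K hK hKN
  have hlaw' : ∀ j : Fin t → ℕ, (∀ i, 1 ≤ j i ∧ j i ≤ u) →
      |(jointCell Ψ K N u j : ℝ) - walshForm θ j * modelCell Ψ K N u j| ≤
        εlaw * N / Real.log N ^ t := fun j hj => by
    simpa only [jointCell, walshForm, modelCell, roughCell] using hlaw j hj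
  have hW := hWE t Ψ K N u L hΨ hN1 (by omega) hL h2 h2L θ hθ2 _ hlaw'
  -- per-scale notation
  set ℓ := Real.log N
  set M := archFactor Ψ K * singularProduct Ψ
  set Ah := ∑ m ∈ Finset.Icc 1 u, (roughCell N u m : ℝ) / N with hAhdef
  set At := |∑ m ∈ Finset.Icc 1 u, (-1 : ℝ) ^ m * ((roughCell N u m : ℝ) / N)| with hAtdef
  set a := (roughCell N u 1 : ℝ) / N with hadef
  set E := εlaw * N / ℓ ^ t with hEdef
  set J := (C₁ + C₂ + 1) * N / ℓ ^ (t + 1) with hJdef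
  have hM0 : 0 ≤ M := mul_nonneg (archFactor_nonneg Ψ K) (singularProduct_nonneg hΨ)
  have hAh : c * u / ℓ ≤ Ah := by
    rw [hAhdef, ← Finset.sum_div, le_div_iff₀ hNpos]
    calc c * u / ℓ * N = c * u * N / ℓ := by ring
      _ ≤ _ := hAsum
  have ha0 : 0 ≤ a := by positivity
  have ha2 : a ≤ 2 / ℓ := by
    rw [hadef, div_le_iff₀ hNpos]
    calc (roughCell N u 1 : ℝ) ≤ 2 * N / ℓ := hA1
      _ = 2 / ℓ * N := by ring
  have ha1 : a ≤ Ah :=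
    Finset.single_le_sum (f := fun m => (roughCell N u m : ℝ) / N) (fun m _ => by positivity)
      (Finset.mem_Icc.mpr ⟨le_rfl, by omega⟩)
  have hAt : At ≤ εM * Ah := by
    have e1 : (∑ m ∈ Finset.Icc 1 u, (-1 : ℝ) ^ m * ((roughCell N u m : ℝ) / N)) =
        (∑ m ∈ Finset.Icc 1 u, (-1 : ℝ) ^ m * (roughCell N u m : ℝ)) / N := by
      rw [Finset.sum_div]; exact Finset.sum_congr rfl fun m _ => (mul_div_assoc _ _ _).symm
    have e2 : Ah = (∑ m ∈ Finset.Icc 1 u, (roughCell N u m : ℝ)) / N := by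
      rw [hAhdef, Finset.sum_div]
    rw [hAtdef, e1, e2, abs_div, abs_of_pos hNpos, ← mul_div_assoc]
    exact div_le_div_of_nonneg_right hbal hNpos.le
  have hJ0 : 0 ≤ J := by positivity
  have hE0 : 0 ≤ E := by positivity
  -- the per-set bound
  have hkey : ∀ S ∈ (Finset.univ : Finset (Finset (Fin t))).erase ∅,
      |θ S| * (M * a ^ t) ≤ (δ + 2 ^ (t + 1) * εM) * (M * a ^ t) + J + (2 / c) ^ t * E := by
    intro S hS
    have hSne : S ≠ ∅ := Finset.ne_of_mem_erase hS
    -- the sieve transfer at `σ = σ_S`: an interval `[m₁, m₂] ⊆ [−N, N]` on which EVERY form is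
    -- `≥ 1` (`hpos`), and the bound by the root-class sums there
    obtain ⟨m₁, m₂, hI, hpos, hb⟩ :=
      hst' N hNst Ψ hΨ hL K hK hKN (tupleSign Ψ S) (tupleSign_eq_one_or Ψ S)
    have hb' : |roughCorrelation Ψ K N u S| ≤ C * Real.exp (-s) * M * ((u : ℝ) / ℓ) ^ t +
        rootClassSums Ψ S m₁ m₂ ⌊(N : ℝ) ^ (2 * s / u)⌋₊ + N / ℓ ^ (t + 1) := hb
    have hP0 : 0 ≤ (N : ℝ) / ℓ ^ (t + 1) := by positivity
    have hcl : rootClassSums Ψ S m₁ m₂ ⌊(N : ℝ) ^ (2 * s / u)⌋₊ ≤ (C₁ + C₂) * N / ℓ ^ (t + 1) := by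
      rcases Nat.lt_or_ge S.card 2 with h1 | h2
      · have hc1 : S.card = 1 := by
          have := (Finset.nonempty_iff_ne_empty.mpr hSne).card_pos; omega
        obtain ⟨i, rfl⟩ := Finset.card_eq_one.mp hc1
        calc rootClassSums Ψ {i} m₁ m₂ ⌊(N : ℝ) ^ (2 * s / u)⌋₊
            ≤ rootClassSums Ψ {i} m₁ m₂ ⌊(N : ℝ) ^ ((1 : ℝ) / 8)⌋₊ :=
              rootClassSums_mono Ψ {i} m₁ m₂ (level_mono hN1 hsu8)
          _ ≤ C₁ * N / ℓ ^ (t + 1) := hsc N hNs Ψ hΨ hL m₁ m₂ hI hpos i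
          _ = C₁ * (N / ℓ ^ (t + 1)) := by ring
          _ ≤ (C₁ + C₂) * (N / ℓ ^ (t + 1)) := mul_le_mul_of_nonneg_right (by linarith) hP0
          _ = (C₁ + C₂) * N / ℓ ^ (t + 1) := by ring
      · -- `|S| ≥ 2`: the POSITIVE weighted class sums, fed with `hpos`
        calc rootClassSums Ψ S m₁ m₂ ⌊(N : ℝ) ^ (2 * s / u)⌋₊
            ≤ rootClassSums Ψ S m₁ m₂ ⌊(N : ℝ) ^ η⌋₊ :=
              rootClassSums_mono Ψ S m₁ m₂ (level_mono hN1 hsuη)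
          _ ≤ C₂ * N / ℓ ^ (t + 1) := hw N hNw Ψ hΨ hL m₁ m₂ hI hpos S h2
          _ = C₂ * (N / ℓ ^ (t + 1)) := by ring
          _ ≤ (C₁ + C₂) * (N / ℓ ^ (t + 1)) := mul_le_mul_of_nonneg_right (by linarith) hP0
          _ = (C₁ + C₂) * N / ℓ ^ (t + 1) := by ring
    have hES : |roughCorrelation Ψ K N u S| ≤ C * Real.exp (-s) * M * ((u : ℝ) / ℓ) ^ t + J := by
      have : J = (C₁ + C₂) * N / ℓ ^ (t + 1) + N / ℓ ^ (t + 1) := by rw [hJdef]; ring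
      rw [this]
      linarith
    exact perSet_bound ht (hW S) hES hM0 hc hAh ha0 ha1 ha2 hℓ1
      (by exact_mod_cast (show 1 ≤ u by omega)) hAt hJ0 hE0 hδ0.le hCs
  -- summing over `S ≠ ∅` and the prime corner
  have hB0 : 0 ≤ (δ + 2 ^ (t + 1) * εM) * (M * a ^ t) + J + (2 / c) ^ t * E := by positivity
  have hsum := sum_erase_mul_le θ hB0 hkey
  have hlaw1 : |(jointCell Ψ K N u (fun _ => 1) : ℝ) - walshForm θ (fun _ => 1) * (M * a ^ t)| ≤ E := by
    have h := hlaw' (fun _ => 1) (fun _ => ⟨le_rfl, by omega⟩)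
    rwa [modelCell_one] at h
  have hfin := corner_cell_le θ hθ0 (by positivity : 0 ≤ M * a ^ t) hlaw1
  have hJ : J ≤ δ * (N / ℓ ^ t) := by
    have h1 : C₁ + C₂ + 1 ≤ δ * ℓ := by
      have := (div_le_iff₀ hδ0).mp hjunk; linarith
    have h2 : J = (C₁ + C₂ + 1) / ℓ * (N / ℓ ^ t) := by
      rw [hJdef, pow_succ]; field_simp
    rw [h2]
    refine mul_le_mul_of_nonneg_right ?_ (by positivity)
    rwa [div_le_iff₀ hℓ0]
  have hfinal := final_budget (t := t) hε.le hc (by positivity : 0 ≤ M * a ^ t)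
    (by positivity : 0 ≤ (N : ℝ) / ℓ ^ t) hδ hεM hεlaw hJ (by rw [hEdef]; ring) hsum
  show |(jointCell Ψ K N u (fun _ => 1) : ℝ) - M * a ^ t| ≤ ε * (M * a ^ t + N / ℓ ^ t)
  exact hfin.trans hfinal

/-! ## Corollaries: the pair content, and the global line theorem recovered from the slices -/

/-- **The PAIR content of the crux.** The pair cell parity law (`CellParityLawAt 2`) and the 2-point
Liouville mean value on positive intervals (`LiouvilleTupleMeanPos 2`) give the counting Dickson–Hardy–Littlewood
law for the joint rough prime cell of every non-degenerate pair of forms (twins, Sophie Germain, binary Goldbach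
cells) with relative + absolute error. [cite: GreenTao2010, Conj. 1.4] -/
theorem primeCellsRelativeAt_two_of_cellParityLawAt_two (hLaw : CellParityLawAt 2)
    (hChowla : LiouvilleTupleMeanPos 2) : PrimeCellsRelativeAt 2 :=
  primeCellsRelativeAt_of_cellParityLawAt 2 (by norm_num) hLaw hChowla

/-- **The global line theorem, recovered from the slices (consistency check).** `CellParityLaw` and
`LiouvilleTupleMeanPos t` for every `t ≥ 2` imply `PrimeCellsRelative`: slice the law
(`cellParityLaw_iff_forall_at`), apply the sliced theorem at each `t ≥ 1` (at `t = 1` the parity input is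
vacuous, `liouvilleTupleMeanPos_of_le_one`), and reassemble (`primeCellsRelative_iff_forall_at`). [folklore] -/
theorem primeCellsRelative_of_cellParityLaw_of_liouvilleTupleMeanPos' (hLaw : CellParityLaw)
    (hChowla : ∀ t : ℕ, 2 ≤ t → LiouvilleTupleMeanPos t) : PrimeCellsRelative :=
  primeCellsRelative_iff_forall_at.mpr fun t ht =>
    primeCellsRelativeAt_of_cellParityLawAt t ht (cellParityLaw_iff_forall_at.mp hLaw t ht)
      ((Nat.lt_or_ge t 2).elim (fun h2 => liouvilleTupleMeanPos_of_le_one (by omega))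
        (fun h2 => hChowla t h2))

end Summit.Parity.GeneralizedHardyLittlewood.Cruxes.PrimeCellsRelative.SieveOutToChowla

end
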